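import Summits.AnomalousDissipation.AnomalousDissipation.Theorems.TaylorCertificatesKolmogorovFloorLineBoundsSums

/-!
# LINE-BOUNDS tools, part 2: sizes of the line sequences (line `Sketch`, crux stmt-AnomalousDissipation-15122)

With one size parameter `Λ ≥ 1` dominating `|a|, |c|, |s|, K, X2, e2, n2` and `1/|G|`, and `Φ ≥ 0` dominating the
force components `‖ve‖, ‖vx‖, ‖vn‖`:

* `‖σ‖ ≤ ΛΦ/π`, `‖ρ‖ ≤ 2Λ²Φ/π`, `‖ρ̃‖ ≤ Λ³Φ/π`, `‖λ±‖ ≤ Λ(Λ³Φ/π + 5ΛΦ/π) ≤ 2Λ⁴Φ` (`π > 3`), hence `‖Λ_m‖ ≤ 2Λ⁴Φ`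
  and `‖y_m‖ ≤ 2Λ⁴Φ/(m²/4) = 8Λ⁴Φ/m²` for every `m` (Lean's `x/0 = 0` makes `m = 0` harmless: `y_0 = 0`);
* vanishing outside the window: `y_m = 0` for `|m| > 2J+1`, `P_m = x_m = z_m = 0` for `|m| > 2J+2`;
* the parity chain: `‖inc(m)‖ ≤ Λ³Y(1/(m−1)² + 1/(m+1)²)` and `‖P_m‖ ≤ 4Λ³Y/|m|` from `‖y_j‖ ≤ Y/j²`
  (telescoping majorant of part 1), and `‖T_m y_m‖ ≤ 2ΛY/|m|` (`|T_m| ≤ |s| + |m|X2 ≤ 2|m|Λ`).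
-/

noncomputable section

set_option linter.dupNamespace false

open Finset
open scoped BigOperators

namespace Summit.AnomalousDissipation.AnomalousDissipation.Theorems.KolmogorovFloor.Response

/-! ## Sizes of `σ, ρ, ρ̃, λ±, Λ_m, y_m` -/

section Sizes

variable (d : LineData) (F : LineForce) (J : ℕ) {Λ Φ : ℝ}

/-- `‖σ‖ ≤ ΛΦ/π`. -/
theorem norm_sigmaC_le (hΛ : 1 ≤ Λ) (hΦ : 0 ≤ Φ) (ha1 : 1 ≤ |d.a|) (hK1 : 1 ≤ d.K)
    (hK : (d.K : ℝ) ≤ Λ) (hvx : ‖F.vx‖ ≤ Φ) : ‖sigmaC d F‖ ≤ Λ * Φ / Real.pi := by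
  have hΛ0 : 0 < Λ := by linarith
  have ha' : (1 : ℝ) ≤ |(d.a : ℝ)| := by rw [← Int.cast_abs]; exact_mod_cast ha1
  have hK' : |(d.K : ℝ)| ≤ Λ := by
    rw [abs_of_pos (by exact_mod_cast (show (0 : ℤ) < d.K by omega))]; exact hK
  unfold sigmaC
  rw [norm_div, norm_mul, norm_mul, Complex.norm_real, Real.norm_eq_abs, abs_of_pos Real.pi_pos,
    Complex.norm_intCast, Complex.norm_intCast, div_le_div_iff₀ (by positivity) Real.pi_pos]
  calc ‖F.vx‖ * |(d.K : ℝ)| * Real.pi ≤ Φ * Λ * Real.pi := by gcongr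
    _ = Λ * Φ * (Real.pi * 1) := by ring
    _ ≤ Λ * Φ * (Real.pi * |(d.a : ℝ)|) := by gcongr

/-- `‖ρ‖ ≤ 2Λ²Φ/π`. -/
theorem norm_rhoC_le (hΛ : 1 ≤ Λ) (hΦ : 0 ≤ Φ) (ha1 : 1 ≤ |d.a|) (he2_1 : 1 ≤ d.e2) (hn2_1 : 1 ≤ d.n2)
    (hc : (|d.c| : ℝ) ≤ Λ) (he2 : (d.e2 : ℝ) ≤ Λ) (hn2 : (d.n2 : ℝ) ≤ Λ)
    (hve : ‖F.ve‖ ≤ Φ) (hvn : ‖F.vn‖ ≤ Φ) : ‖rhoC d F‖ ≤ 2 * Λ ^ 2 * Φ / Real.pi := by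
  have hΛ0 : 0 < Λ := by linarith
  have ha' : (1 : ℝ) ≤ |(d.a : ℝ)| := by rw [← Int.cast_abs]; exact_mod_cast ha1
  have he2' : |(d.e2 : ℝ)| ≤ Λ := by
    rwa [abs_of_pos (by exact_mod_cast (show (0 : ℤ) < d.e2 by omega))]
  have hn2' : |(d.n2 : ℝ)| ≤ Λ := by
    rwa [abs_of_pos (by exact_mod_cast (show (0 : ℤ) < d.n2 by omega))]
  unfold rhoC
  rw [norm_div, norm_mul, Complex.norm_real, Real.norm_eq_abs, abs_of_pos Real.pi_pos,
    Complex.norm_intCast]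
  have hnum : ‖(d.c : ℂ) * (d.e2 : ℂ) * F.ve - (d.a : ℂ) * (d.n2 : ℂ) * F.vn‖ ≤
      Λ * Λ * Φ + |(d.a : ℝ)| * Λ * Φ := by
    refine (norm_sub_le _ _).trans ?_
    rw [norm_mul, norm_mul, norm_mul, norm_mul, Complex.norm_intCast, Complex.norm_intCast,
      Complex.norm_intCast, Complex.norm_intCast]
    gcongr
  have h1 : Λ * Λ * Φ ≤ Λ * Λ * Φ * |(d.a : ℝ)| := le_mul_of_one_le_right (by positivity) ha'
  have h2 : |(d.a : ℝ)| * Λ * Φ ≤ |(d.a : ℝ)| * (Λ * Λ) * Φ := by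
    apply mul_le_mul_of_nonneg_right _ hΦ
    apply mul_le_mul_of_nonneg_left _ (abs_nonneg _)
    exact le_mul_of_one_le_left hΛ0.le hΛ
  rw [div_le_div_iff₀ (by positivity) Real.pi_pos]
  calc ‖(d.c : ℂ) * (d.e2 : ℂ) * F.ve - (d.a : ℂ) * (d.n2 : ℂ) * F.vn‖ * Real.pi
      ≤ (Λ * Λ * Φ + |(d.a : ℝ)| * Λ * Φ) * Real.pi := by gcongr
    _ ≤ (Λ * Λ * Φ * |(d.a : ℝ)| + |(d.a : ℝ)| * (Λ * Λ) * Φ) * Real.pi :=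
        mul_le_mul_of_nonneg_right (add_le_add h1 h2) Real.pi_pos.le
    _ = 2 * Λ ^ 2 * Φ * (Real.pi * |(d.a : ℝ)|) := by ring

/-- `‖ρ̃‖ ≤ Λ³Φ/π`. -/
theorem norm_rhoT_le (hΛ : 1 ≤ Λ) (hΦ : 0 ≤ Φ) (ha1 : 1 ≤ |d.a|) (hc1 : 1 ≤ |d.c|) (hX2_1 : 1 ≤ d.X2)
    (he2_1 : 1 ≤ d.e2) (hn2_1 : 1 ≤ d.n2) (ha : (|d.a| : ℝ) ≤ Λ) (hc : (|d.c| : ℝ) ≤ Λ)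
    (he2 : (d.e2 : ℝ) ≤ Λ) (hn2 : (d.n2 : ℝ) ≤ Λ) (hve : ‖F.ve‖ ≤ Φ) (hvn : ‖F.vn‖ ≤ Φ) :
    ‖rhoT d F‖ ≤ Λ ^ 3 * Φ / Real.pi := by
  have hΛ0 : 0 < Λ := by linarith
  have hρ := norm_rhoC_le d F hΛ hΦ ha1 he2_1 hn2_1 hc he2 hn2 hve hvn
  have hX2' : (1 : ℝ) ≤ |(d.X2 : ℝ)| := by
    rw [abs_of_pos (by exact_mod_cast (show (0 : ℤ) < d.X2 by omega))]; exact_mod_cast hX2_1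
  have hc' : (1 : ℝ) ≤ |(d.c : ℝ)| := by rw [← Int.cast_abs]; exact_mod_cast hc1
  have he2' : (1 : ℝ) ≤ |(d.e2 : ℝ)| := by
    rw [abs_of_pos (by exact_mod_cast (show (0 : ℤ) < d.e2 by omega))]; exact_mod_cast he2_1
  unfold rhoT
  rw [norm_div, norm_mul, norm_mul, norm_mul, norm_mul, Complex.norm_two, Complex.norm_intCast,
    Complex.norm_intCast, Complex.norm_intCast, Complex.norm_intCast]
  have hden : (2 : ℝ) ≤ 2 * |(d.X2 : ℝ)| * |(d.c : ℝ)| * |(d.e2 : ℝ)| := by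
    calc (2 : ℝ) = 2 * 1 * 1 * 1 := by norm_num
      _ ≤ 2 * |(d.X2 : ℝ)| * |(d.c : ℝ)| * |(d.e2 : ℝ)| := by gcongr
  have hnum : ‖rhoC d F‖ * |(d.a : ℝ)| ≤ 2 * Λ ^ 2 * Φ / Real.pi * Λ :=
    mul_le_mul hρ ha (abs_nonneg _) (by positivity)
  calc ‖rhoC d F‖ * |(d.a : ℝ)| / (2 * |(d.X2 : ℝ)| * |(d.c : ℝ)| * |(d.e2 : ℝ)|)
      ≤ (2 * Λ ^ 2 * Φ / Real.pi * Λ) / 2 := div_le_div₀ (by positivity) hnum (by norm_num) hden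
    _ = Λ ^ 3 * Φ / Real.pi := by ring

/-- Common core of the `λ±` bounds: `‖N/G‖ ≤ 2Λ⁴Φ` once `‖N‖ ≤ Λ³Φ/π + 5ΛΦ/π` and `1/|G| ≤ Λ` (`π > 3`). -/
theorem norm_div_G_le {N : ℂ} (hΛ : 1 ≤ Λ) (hΦ : 0 ≤ Φ) (hG : Λ⁻¹ ≤ |d.G J|)
    (hN : ‖N‖ ≤ Λ ^ 3 * Φ / Real.pi + Λ * Φ / Real.pi * 5) : ‖N / (d.G J : ℂ)‖ ≤ 2 * Λ ^ 4 * Φ := by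
  have hΛ0 : 0 < Λ := by linarith
  rw [norm_div, Complex.norm_real, Real.norm_eq_abs]
  have hΛ24 : Λ ^ 2 * Φ ≤ Λ ^ 4 * Φ :=
    mul_le_mul_of_nonneg_right (pow_le_pow_right₀ hΛ (by norm_num)) hΦ
  have hpi : 6 / Real.pi ≤ (2 : ℝ) := by
    rw [div_le_iff₀ Real.pi_pos]; linarith [Real.pi_gt_three]
  calc ‖N‖ / |d.G J| ≤ (Λ ^ 3 * Φ / Real.pi + Λ * Φ / Real.pi * 5) / Λ⁻¹ :=
        div_le_div₀ (by positivity) hN (inv_pos.mpr hΛ0) hG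
    _ = (Λ ^ 4 * Φ + 5 * (Λ ^ 2 * Φ)) / Real.pi := by rw [div_inv_eq_mul]; ring
    _ ≤ (Λ ^ 4 * Φ + 5 * (Λ ^ 4 * Φ)) / Real.pi := by gcongr
    _ = Λ ^ 4 * Φ * (6 / Real.pi) := by ring
    _ ≤ Λ ^ 4 * Φ * 2 := by gcongr
    _ = 2 * Λ ^ 4 * Φ := by ring

/-- `‖λ₊‖ ≤ 2Λ⁴Φ`. -/
theorem norm_lamP_le (hΛ : 1 ≤ Λ) (hΦ : 0 ≤ Φ) (ha1 : 1 ≤ |d.a|) (hc1 : 1 ≤ |d.c|) (hK1 : 1 ≤ d.K)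
    (hX2_1 : 1 ≤ d.X2) (he2_1 : 1 ≤ d.e2) (hn2_1 : 1 ≤ d.n2) (ha : (|d.a| : ℝ) ≤ Λ)
    (hc : (|d.c| : ℝ) ≤ Λ) (hK : (d.K : ℝ) ≤ Λ) (he2 : (d.e2 : ℝ) ≤ Λ) (hn2 : (d.n2 : ℝ) ≤ Λ)
    (hG : Λ⁻¹ ≤ |d.G J|) (hE : ∀ m : ℤ, m % 2 = 1 → d.E m ≠ 0)
    (hE3 : ∀ m : ℤ, 3 ≤ |m| → m ^ 2 * d.X2 ≤ 4 * d.E m)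
    (hve : ‖F.ve‖ ≤ Φ) (hvx : ‖F.vx‖ ≤ Φ) (hvn : ‖F.vn‖ ≤ Φ) :
    ‖lamP d F J‖ ≤ 2 * Λ ^ 4 * Φ := by
  have hσ := norm_sigmaC_le d F hΛ hΦ ha1 hK1 hK hvx
  have hρT := norm_rhoT_le d F hΛ hΦ ha1 hc1 hX2_1 he2_1 hn2_1 ha hc he2 hn2 hve hvn
  have hGm := d.abs_Gm_le hX2_1 hE hE3 J
  have hΛ0 : 0 < Λ := by linarith
  unfold lamP
  refine norm_div_G_le d J hΛ hΦ hG ((norm_sub_le _ _).trans ?_)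
  rw [norm_mul, Complex.norm_real, Real.norm_eq_abs]
  gcongr

/-- `‖λ₋‖ ≤ 2Λ⁴Φ`. -/
theorem norm_lamM_le (hΛ : 1 ≤ Λ) (hΦ : 0 ≤ Φ) (ha1 : 1 ≤ |d.a|) (hc1 : 1 ≤ |d.c|) (hK1 : 1 ≤ d.K)
    (hX2_1 : 1 ≤ d.X2) (he2_1 : 1 ≤ d.e2) (hn2_1 : 1 ≤ d.n2) (ha : (|d.a| : ℝ) ≤ Λ)
    (hc : (|d.c| : ℝ) ≤ Λ) (hK : (d.K : ℝ) ≤ Λ) (he2 : (d.e2 : ℝ) ≤ Λ) (hn2 : (d.n2 : ℝ) ≤ Λ)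
    (hG : Λ⁻¹ ≤ |d.G J|) (hE : ∀ m : ℤ, m % 2 = 1 → d.E m ≠ 0)
    (hE3 : ∀ m : ℤ, 3 ≤ |m| → m ^ 2 * d.X2 ≤ 4 * d.E m)
    (hve : ‖F.ve‖ ≤ Φ) (hvx : ‖F.vx‖ ≤ Φ) (hvn : ‖F.vn‖ ≤ Φ) :
    ‖lamM d F J‖ ≤ 2 * Λ ^ 4 * Φ := by
  have hσ := norm_sigmaC_le d F hΛ hΦ ha1 hK1 hK hvx
  have hρT := norm_rhoT_le d F hΛ hΦ ha1 hc1 hX2_1 he2_1 hn2_1 ha hc he2 hn2 hve hvn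
  have hGp := d.abs_Gp_le hX2_1 hE hE3 J
  have hΛ0 : 0 < Λ := by linarith
  unfold lamM
  refine norm_div_G_le d J hΛ hΦ hG ((norm_add_le _ _).trans ?_)
  rw [norm_mul, Complex.norm_real, Real.norm_eq_abs]
  gcongr

/-- `‖Λ_m‖ ≤ 2Λ⁴Φ` for every `m`. -/
theorem norm_Lam_le (hΛ : 1 ≤ Λ) (hΦ : 0 ≤ Φ) (ha1 : 1 ≤ |d.a|) (hc1 : 1 ≤ |d.c|) (hK1 : 1 ≤ d.K)
    (hX2_1 : 1 ≤ d.X2) (he2_1 : 1 ≤ d.e2) (hn2_1 : 1 ≤ d.n2) (ha : (|d.a| : ℝ) ≤ Λ)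
    (hc : (|d.c| : ℝ) ≤ Λ) (hK : (d.K : ℝ) ≤ Λ) (he2 : (d.e2 : ℝ) ≤ Λ) (hn2 : (d.n2 : ℝ) ≤ Λ)
    (hG : Λ⁻¹ ≤ |d.G J|) (hE : ∀ m : ℤ, m % 2 = 1 → d.E m ≠ 0)
    (hE3 : ∀ m : ℤ, 3 ≤ |m| → m ^ 2 * d.X2 ≤ 4 * d.E m)
    (hve : ‖F.ve‖ ≤ Φ) (hvx : ‖F.vx‖ ≤ Φ) (hvn : ‖F.vn‖ ≤ Φ) (m : ℤ) :
    ‖Lam d F J m‖ ≤ 2 * Λ ^ 4 * Φ := by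
  unfold Lam
  split_ifs
  · rw [norm_zero]; positivity
  · exact norm_lamP_le d F J hΛ hΦ ha1 hc1 hK1 hX2_1 he2_1 hn2_1 ha hc hK he2 hn2 hG hE hE3 hve hvx hvn
  · exact norm_lamM_le d F J hΛ hΦ ha1 hc1 hK1 hX2_1 he2_1 hn2_1 ha hc hK he2 hn2 hG hE hE3 hve hvx hvn

/-- From a uniform bound `‖Λ_m‖ ≤ B`: `‖y_m‖ ≤ 4B/m²` for every `m` (both sides vanish at `m = 0`). -/
theorem norm_yC_le_of {B : ℝ} (hB : 0 ≤ B) (hLam : ∀ m : ℤ, ‖Lam d F J m‖ ≤ B) (hX2_1 : 1 ≤ d.X2)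
    (hE : ∀ m : ℤ, m % 2 = 1 → d.E m ≠ 0) (hE3 : ∀ m : ℤ, 3 ≤ |m| → m ^ 2 * d.X2 ≤ 4 * d.E m)
    (m : ℤ) : ‖yC d F J m‖ ≤ 4 * B / (m : ℝ) ^ 2 := by
  unfold yC
  rcases Int.emod_two_eq_zero_or_one m with hm | hm
  · have h0 : Lam d F J m = 0 := by simp [Lam, hm]
    rw [h0, zero_div, norm_zero]
    positivity
  · have hE' := d.sq_div_four_le_abs_E hX2_1 hE hE3 hm
    have hm0 : (m : ℝ) ≠ 0 := by exact_mod_cast (show m ≠ 0 by omega)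
    have hpos : (0 : ℝ) < (m : ℝ) ^ 2 / 4 := by positivity
    rw [norm_div, Complex.norm_intCast]
    calc ‖Lam d F J m‖ / |(d.E m : ℝ)| ≤ B / ((m : ℝ) ^ 2 / 4) :=
          div_le_div₀ hB (hLam m) hpos hE'
      _ = 4 * B / (m : ℝ) ^ 2 := by
          field_simp

/-- `‖y_m‖ ≤ 8Λ⁴Φ/m²` for every `m`. -/
theorem norm_yC_le (hΛ : 1 ≤ Λ) (hΦ : 0 ≤ Φ) (ha1 : 1 ≤ |d.a|) (hc1 : 1 ≤ |d.c|) (hK1 : 1 ≤ d.K)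
    (hX2_1 : 1 ≤ d.X2) (he2_1 : 1 ≤ d.e2) (hn2_1 : 1 ≤ d.n2) (ha : (|d.a| : ℝ) ≤ Λ)
    (hc : (|d.c| : ℝ) ≤ Λ) (hK : (d.K : ℝ) ≤ Λ) (he2 : (d.e2 : ℝ) ≤ Λ) (hn2 : (d.n2 : ℝ) ≤ Λ)
    (hG : Λ⁻¹ ≤ |d.G J|) (hE : ∀ m : ℤ, m % 2 = 1 → d.E m ≠ 0)
    (hE3 : ∀ m : ℤ, 3 ≤ |m| → m ^ 2 * d.X2 ≤ 4 * d.E m)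
    (hve : ‖F.ve‖ ≤ Φ) (hvx : ‖F.vx‖ ≤ Φ) (hvn : ‖F.vn‖ ≤ Φ) (m : ℤ) :
    ‖yC d F J m‖ ≤ 8 * Λ ^ 4 * Φ / (m : ℝ) ^ 2 := by
  have h := norm_yC_le_of d F J (B := 2 * Λ ^ 4 * Φ) (by positivity)
    (norm_Lam_le d F J hΛ hΦ ha1 hc1 hK1 hX2_1 he2_1 hn2_1 ha hc hK he2 hn2 hG hE hE3 hve hvx hvn)
    hX2_1 hE hE3 m
  calc ‖yC d F J m‖ ≤ 4 * (2 * Λ ^ 4 * Φ) / (m : ℝ) ^ 2 := h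
    _ = 8 * Λ ^ 4 * Φ / (m : ℝ) ^ 2 := by ring

end Sizes

/-! ## Vanishing outside the window -/

section LineBounds

variable (d : LineData) (F : LineForce) (J : ℕ) {Λ Φ : ℝ}

/-- `y_m = 0` for `|m| > 2J+1`. -/
theorem yC_eq_zero_of_lt {m : ℤ} (hm : 2 * (J : ℤ) + 1 < |m|) : yC d F J m = 0 := by
  simp [yC, Lam, hm]

/-- `P_m = 0` for `|m| > 2J+2` (the defining sums are empty). -/
theorem PC_eq_zero_of_lt {m : ℤ} (hm : 2 * (J : ℤ) + 2 < |m|) : PC d F J m = 0 := by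
  unfold PC
  split_ifs with h1 h2
  · rfl
  · rw [neg_eq_zero]
    apply sum_eq_zero
    intro i hi
    rw [mem_filter, mem_range] at hi
    rw [abs_of_pos h2] at hm
    omega
  · apply sum_eq_zero
    intro i hi
    rw [mem_filter, mem_range] at hi
    rw [abs_of_nonpos (not_lt.mp h2)] at hm
    omega

/-- `x_m = 0` for `|m| > 2J+2`. -/
theorem xC_eq_zero_of_lt {m : ℤ} (hm : 2 * (J : ℤ) + 2 < |m|) : xC d F J m = 0 := by
  simp [xC, PC_eq_zero_of_lt d F J hm, yC_eq_zero_of_lt d F J (lt_trans (by linarith) hm)]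

/-- `z_m = 0` for `|m| > 2J+2`. -/
theorem zC_eq_zero_of_lt {m : ℤ} (hm : 2 * (J : ℤ) + 2 < |m|) : zC d F J m = 0 := by
  simp [zC, PC_eq_zero_of_lt d F J hm, yC_eq_zero_of_lt d F J (lt_trans (by linarith) hm)]

/-! ## The parity chain `P`, the products `T_m y_m`, and `x, z` -/

/-- `‖inc(m)‖ ≤ Λ³·Y·(1/(m−1)² + 1/(m+1)²)` at `m ≠ 0`, from `‖y_j‖ ≤ Y/j²`. -/
theorem norm_incC_le_of {Y : ℝ} (hy : ∀ j : ℤ, ‖yC d F J j‖ ≤ Y / (j : ℝ) ^ 2)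
    (hΛ : 1 ≤ Λ) (ha1 : 1 ≤ |d.a|) (hX2_1 : 1 ≤ d.X2) (he2_1 : 1 ≤ d.e2)
    (hc : (|d.c| : ℝ) ≤ Λ) (hX2 : (d.X2 : ℝ) ≤ Λ) (he2 : (d.e2 : ℝ) ≤ Λ) {m : ℤ} (hm : m ≠ 0) :
    ‖incC d F J m‖ ≤ Λ ^ 3 * Y * (1 / ((m : ℝ) - 1) ^ 2 + 1 / ((m : ℝ) + 1) ^ 2) := by
  have hΛ0 : 0 < Λ := by linarith
  have ha' : (1 : ℝ) ≤ |(d.a : ℝ)| := by rw [← Int.cast_abs]; exact_mod_cast ha1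
  have hX2' : |(d.X2 : ℝ)| ≤ Λ := by
    rwa [abs_of_pos (by exact_mod_cast (show (0 : ℤ) < d.X2 by omega))]
  have he2' : |(d.e2 : ℝ)| ≤ Λ := by
    rwa [abs_of_pos (by exact_mod_cast (show (0 : ℤ) < d.e2 by omega))]
  have hcoef : ‖(d.X2 : ℂ) * (d.c : ℂ) * (d.e2 : ℂ) / (d.a : ℂ)‖ ≤ Λ ^ 3 := by
    rw [norm_div, norm_mul, norm_mul, Complex.norm_intCast, Complex.norm_intCast,
      Complex.norm_intCast, Complex.norm_intCast, div_le_iff₀ (by positivity)]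
    calc |(d.X2 : ℝ)| * |(d.c : ℝ)| * |(d.e2 : ℝ)| ≤ Λ * Λ * Λ := by gcongr
      _ = Λ ^ 3 * 1 := by ring
      _ ≤ Λ ^ 3 * |(d.a : ℝ)| := by gcongr
  have hsum : ‖yC d F J (m - 1) + yC d F J (m + 1)‖ ≤
      Y / ((m : ℝ) - 1) ^ 2 + Y / ((m : ℝ) + 1) ^ 2 := by
    refine (norm_add_le _ _).trans (add_le_add ?_ ?_)
    · have := hy (m - 1); push_cast at this; exact this
    · have := hy (m + 1); push_cast at this; exact this
  unfold incC
  rw [if_neg hm, sub_zero, norm_mul]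
  calc ‖(d.X2 : ℂ) * (d.c : ℂ) * (d.e2 : ℂ) / (d.a : ℂ)‖ * ‖yC d F J (m - 1) + yC d F J (m + 1)‖
      ≤ Λ ^ 3 * (Y / ((m : ℝ) - 1) ^ 2 + Y / ((m : ℝ) + 1) ^ 2) :=
        mul_le_mul hcoef hsum (norm_nonneg _) (by positivity)
    _ = Λ ^ 3 * Y * (1 / ((m : ℝ) - 1) ^ 2 + 1 / ((m : ℝ) + 1) ^ 2) := by ring

/-- `‖P_m‖ ≤ 4Λ³Y/|m|` for every `m`, from `‖y_j‖ ≤ Y/j²` (telescoping over the parity chain). -/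
theorem norm_PC_le_of {Y : ℝ} (hY : 0 ≤ Y) (hy : ∀ j : ℤ, ‖yC d F J j‖ ≤ Y / (j : ℝ) ^ 2)
    (hΛ : 1 ≤ Λ) (ha1 : 1 ≤ |d.a|) (hX2_1 : 1 ≤ d.X2) (he2_1 : 1 ≤ d.e2)
    (hc : (|d.c| : ℝ) ≤ Λ) (hX2 : (d.X2 : ℝ) ≤ Λ) (he2 : (d.e2 : ℝ) ≤ Λ) (m : ℤ) :
    ‖PC d F J m‖ ≤ 4 * Λ ^ 3 * Y / |(m : ℝ)| := by
  have hΛ0 : 0 < Λ := by linarith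
  have hinc : ∀ {n : ℤ}, n ≠ 0 →
      ‖incC d F J n‖ ≤ Λ ^ 3 * Y * (1 / ((n : ℝ) - 1) ^ 2 + 1 / ((n : ℝ) + 1) ^ 2) :=
    fun hn => norm_incC_le_of d F J hy hΛ ha1 hX2_1 he2_1 hc hX2 he2 hn
  unfold PC
  split_ifs with h1 h2
  · rw [norm_zero]; positivity
  · -- `m` odd and positive: `m = 2n₀ − 1`
    obtain ⟨n₀, hn₀, hn₀1⟩ : ∃ n₀ : ℕ, m = 2 * (n₀ : ℤ) - 1 ∧ 1 ≤ n₀ :=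
      ⟨m.toNat / 2 + 1, by omega, by omega⟩
    have hn₀R : (1 : ℝ) ≤ n₀ := by exact_mod_cast hn₀1
    have hmR : (m : ℝ) = 2 * (n₀ : ℝ) - 1 := by rw [hn₀]; push_cast; ring
    have hmabs : |(m : ℝ)| = 2 * (n₀ : ℝ) - 1 := by rw [hmR]; exact abs_of_pos (by linarith)
    rw [norm_neg, hmabs]
    set S := (range (J + 2)).filter (fun i : ℕ => m < 2 * (i : ℤ)) with hS
    have hSmem : ∀ i ∈ S, n₀ ≤ i ∧ i < J + 2 := by
      intro i hi
      rw [hS, mem_filter, mem_range] at hi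
      omega
    calc ‖∑ i ∈ S, incC d F J (2 * (i : ℤ))‖ ≤ ∑ i ∈ S, ‖incC d F J (2 * (i : ℤ))‖ := norm_sum_le _ _
      _ ≤ ∑ i ∈ S, Λ ^ 3 * Y * (1 / (2 * (i : ℝ) - 1) ^ 2 + 1 / (2 * (i : ℝ) + 1) ^ 2) := by
          apply sum_le_sum
          intro i hi
          have hi0 : (2 * (i : ℤ)) ≠ 0 := by have := hSmem i hi; omega
          have := hinc hi0
          push_cast at this
          exact this
      _ = Λ ^ 3 * Y * ∑ i ∈ S, (1 / (2 * (i : ℝ) - 1) ^ 2 + 1 / (2 * (i : ℝ) + 1) ^ 2) := by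
          rw [mul_sum]
      _ ≤ Λ ^ 3 * Y * (4 / (2 * (n₀ : ℝ) - 1)) := by
          gcongr
          exact sum_inv_sq_pair_le S n₀ (J + 2) hn₀1 hSmem
      _ = 4 * Λ ^ 3 * Y / (2 * (n₀ : ℝ) - 1) := by ring
  · -- `m` odd and negative: `-m = 2n₀ − 1`
    obtain ⟨n₀, hn₀, hn₀1⟩ : ∃ n₀ : ℕ, m = -(2 * (n₀ : ℤ) - 1) ∧ 1 ≤ n₀ :=
      ⟨(-m).toNat / 2 + 1, by omega, by omega⟩
    have hn₀R : (1 : ℝ) ≤ n₀ := by exact_mod_cast hn₀1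
    have hmR : (m : ℝ) = -(2 * (n₀ : ℝ) - 1) := by rw [hn₀]; push_cast; ring
    have hmabs : |(m : ℝ)| = 2 * (n₀ : ℝ) - 1 := by
      rw [hmR, abs_neg]; exact abs_of_pos (by linarith)
    rw [hmabs]
    set S := (range (J + 2)).filter (fun i : ℕ => -m < 2 * (i : ℤ)) with hS
    have hSmem : ∀ i ∈ S, n₀ ≤ i ∧ i < J + 2 := by
      intro i hi
      rw [hS, mem_filter, mem_range] at hi
      omega
    calc ‖∑ i ∈ S, incC d F J (-(2 * (i : ℤ)))‖
        ≤ ∑ i ∈ S, ‖incC d F J (-(2 * (i : ℤ)))‖ := norm_sum_le _ _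
      _ ≤ ∑ i ∈ S, Λ ^ 3 * Y * (1 / (2 * (i : ℝ) - 1) ^ 2 + 1 / (2 * (i : ℝ) + 1) ^ 2) := by
          apply sum_le_sum
          intro i hi
          have hi0 : (-(2 * (i : ℤ))) ≠ 0 := by have := hSmem i hi; omega
          have := hinc hi0
          push_cast at this
          calc ‖incC d F J (-(2 * (i : ℤ)))‖ ≤ _ := this
            _ = Λ ^ 3 * Y * (1 / (2 * (i : ℝ) - 1) ^ 2 + 1 / (2 * (i : ℝ) + 1) ^ 2) := by ring
      _ = Λ ^ 3 * Y * ∑ i ∈ S, (1 / (2 * (i : ℝ) - 1) ^ 2 + 1 / (2 * (i : ℝ) + 1) ^ 2) := by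
          rw [mul_sum]
      _ ≤ Λ ^ 3 * Y * (4 / (2 * (n₀ : ℝ) - 1)) := by
          gcongr
          exact sum_inv_sq_pair_le S n₀ (J + 2) hn₀1 hSmem
      _ = 4 * Λ ^ 3 * Y / (2 * (n₀ : ℝ) - 1) := by ring

/-- `‖T_m y_m‖ ≤ 2ΛY/|m|` for every `m`, from `‖y_j‖ ≤ Y/j²` and `|T_m| ≤ |s| + |m| X2 ≤ 2|m|Λ`. -/
theorem norm_T_mul_yC_le_of {Y : ℝ} (hY : 0 ≤ Y) (hy : ∀ j : ℤ, ‖yC d F J j‖ ≤ Y / (j : ℝ) ^ 2)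
    (hΛ : 1 ≤ Λ) (hX2_1 : 1 ≤ d.X2) (hs : (|d.s| : ℝ) ≤ Λ) (hX2 : (d.X2 : ℝ) ≤ Λ) (m : ℤ) :
    ‖(d.T m : ℂ) * yC d F J m‖ ≤ 2 * Λ * Y / |(m : ℝ)| := by
  have hΛ0 : 0 < Λ := by linarith
  rcases eq_or_ne m 0 with rfl | hm
  · have h0 : yC d F J 0 = 0 := by simp [yC, Lam]
    rw [h0, mul_zero, norm_zero]
    positivity
  · have hmr0 : (m : ℝ) ≠ 0 := by exact_mod_cast hm
    have habs0 : |(m : ℝ)| ≠ 0 := abs_ne_zero.mpr hmr0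
    have hm1 : (1 : ℝ) ≤ |(m : ℝ)| := by rw [← Int.cast_abs]; exact_mod_cast Int.one_le_abs hm
    have hX2' : |(d.X2 : ℝ)| ≤ Λ := by
      rwa [abs_of_pos (by exact_mod_cast (show (0 : ℤ) < d.X2 by omega))]
    have hT : ‖(d.T m : ℂ)‖ ≤ 2 * |(m : ℝ)| * Λ := by
      rw [Complex.norm_intCast, LineData.T]
      push_cast
      calc |(d.s : ℝ) + (m : ℝ) * (d.X2 : ℝ)| ≤ |(d.s : ℝ)| + |(m : ℝ)| * |(d.X2 : ℝ)| := by
            refine (abs_add_le _ _).trans ?_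
            rw [abs_mul]
        _ ≤ Λ + |(m : ℝ)| * Λ := by gcongr
        _ ≤ |(m : ℝ)| * Λ + |(m : ℝ)| * Λ := by gcongr; exact le_mul_of_one_le_left hΛ0.le hm1
        _ = 2 * |(m : ℝ)| * Λ := by ring
    have hmsq : (m : ℝ) ^ 2 = |(m : ℝ)| * |(m : ℝ)| := by rw [← sq, sq_abs]
    rw [norm_mul]
    calc ‖(d.T m : ℂ)‖ * ‖yC d F J m‖ ≤ (2 * |(m : ℝ)| * Λ) * (Y / (m : ℝ) ^ 2) :=
          mul_le_mul hT (hy m) (norm_nonneg _) (by positivity)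
      _ = 2 * Λ * Y / |(m : ℝ)| := by
          rw [hmsq]
          field_simp

end LineBounds

end Summit.AnomalousDissipation.AnomalousDissipation.Theorems.KolmogorovFloor.Response
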